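import Summits.NavierStokesRegularity.NavierStokesRegularity.Theses.BernoulliDeceleration
import HarnessLib

/-!
# Birth skeleton of the child `BoundedFlowHeadCeiling` (split of `DeceleratingSetHeadBound`)

Support child C3 of the prepared split of stmt-NavierStokesRegularity-3032: "a velocity bounded on
every `(δ, T) × ℝ³` has its Bernoulli head bounded above on `[0, T) × ℝ³`". Line:

* `stub_boundedNearInitialTime` — the classical Leray–Hopf solution from a rapidly decaying
  datum is bounded on `[0, δ] × ℝ³` for some `δ ∈ (0, T)` (local strong theory + weak–strong
  uniqueness: it is the Kato/Leray strong solution near `t = 0`; far field alternatively by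
  `SereginSverak2002.farField_bound` on `(δ', T)` and compactness near field);
* `stub_headCeilingOfVelocityBound` — a velocity bounded on `[0, T) × ℝ³` has bounded head there:
  uniform Lipschitz bounds for bounded classical Leray–Hopf solutions (parabolic / Serrin interior
  estimates, far field included) and the PV bound `abs_normalisedPressure_le`
  (`|p̃[v](x)| ≤ M₀²/3 + 8 M₀ M₁ + ∫‖v‖²/(2π)`, NormalisedPressureDuality.lean) with the energy bound
  `SereginSverak2002.eEnergy_le`.

`BoundedFlowHeadCeiling_of` glues the two time ranges `[0, δ]` and `(δ, T)`.
-/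

set_option linter.dupNamespace false

namespace Summit.NavierStokesRegularity.NavierStokesRegularity.Cruxes.DeceleratingSetHeadBound.BirthBoundedFlowHeadCeiling

open Set Metric Function
open Literature.Analysis.FluidPDE
open Summit.NavierStokesRegularity.NavierStokesRegularity.Theses.BernoulliDeceleration

/-- Local copy of the child (VERBATIM the `statement` of `BoundedFlowHeadCeiling` in
children.json; after the split, the route decl of the same name). -/
def BoundedFlowHeadCeiling : Prop :=
  ∀ (ν T : ℝ), 0 < ν → 0 < T → ∀ (u : ℝ → EuclideanSpace ℝ (Fin 3) → EuclideanSpace ℝ (Fin 3)) (p : ℝ → EuclideanSpace ℝ (Fin 3) → ℝ), Literature.Analysis.FluidPDE.IsClassicalNSSolutionOn (Set.Ico 0 T) ν 0 u p → Literature.Analysis.FluidPDE.IsLerayHopfOn T ν 0 (u 0) u → Literature.Analysis.FluidPDE.HasRapidSpatialDecay (u 0) → (∀ δ ∈ Set.Ioo 0 T, ∃ M : ℝ, ∀ t ∈ Set.Ioo δ T, ∀ x, ‖u t x‖ ≤ M) → ∃ K : ℝ, ∀ t ∈ Set.Ico 0 T, ∀ x, ‖u t x‖ ^ 2 / 2 +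 Literature.Analysis.FluidPDE.normalisedPressure (u t) x ≤ K

/-- Stub 1's statement: boundedness up to some positive time. -/
def BoundedNearInitialTime : Prop :=
  ∀ (ν T : ℝ), 0 < ν → 0 < T → ∀ (u : ℝ → EuclideanSpace ℝ (Fin 3) → EuclideanSpace ℝ (Fin 3)) (p : ℝ → EuclideanSpace ℝ (Fin 3) → ℝ), Literature.Analysis.FluidPDE.IsClassicalNSSolutionOn (Set.Ico 0 T) ν 0 u p → Literature.Analysis.FluidPDE.IsLerayHopfOn T ν 0 (u 0) u → Literature.Analysis.FluidPDE.HasRapidSpatialDecay (u 0) → ∃ δ ∈ Set.Ioo 0 T, ∃ M : ℝ, ∀ t ∈ Set.Icc 0 δ, ∀ x, ‖u t x‖ ≤ M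

/-- Stub 2's statement: a velocity bound on `[0, T) × ℝ³` bounds the head there. -/
def HeadCeilingOfVelocityBound : Prop :=
  ∀ (ν T : ℝ), 0 < ν → 0 < T → ∀ (u : ℝ → EuclideanSpace ℝ (Fin 3) → EuclideanSpace ℝ (Fin 3)) (p : ℝ → EuclideanSpace ℝ (Fin 3) → ℝ), Literature.Analysis.FluidPDE.IsClassicalNSSolutionOn (Set.Ico 0 T) ν 0 u p → Literature.Analysis.FluidPDE.IsLerayHopfOn T ν 0 (u 0) u → Literature.Analysis.FluidPDE.HasRapidSpatialDecay (u 0) → ∀ M : ℝ, (∀ t ∈ Set.Ico 0 T, ∀ x, ‖u t x‖ ≤ M) → ∃ K : ℝ, ∀ t ∈ Set.Ico 0 T, ∀ x, ‖u t x‖ ^ 2 / 2 + Literature.Analysis.FluidPDE.normalisedPressure (u t) x ≤ K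

/-- STUB 1: bounded on `[0, δ] × ℝ³` for some `δ ∈ (0, T)`. [M; local strong theory +
weak–strong uniqueness in the tree's classes] -/
theorem stub_boundedNearInitialTime : BoundedNearInitialTime := by
  sorry

/-- STUB 2: velocity bounded on `[0, T) × ℝ³` ⟹ head bounded above there. [M/L; gradient bounds
for bounded solutions + `abs_normalisedPressure_le` + energy] -/
theorem stub_headCeilingOfVelocityBound : HeadCeilingOfVelocityBound := by
  sorry

/-- **The child from the stubs**: glue the bound on `[0, δ]` (stub 1) with the hypothesis on
`(δ, T)`, then apply stub 2. -/
theorem BoundedFlowHeadCeiling_of :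
    BoundedNearInitialTime → HeadCeilingOfVelocityBound → BoundedFlowHeadCeiling := by
  intro h₁ h₂ ν T hν hT u p hsol hLH hdec hbdd
  obtain ⟨δ, hδ, M₀, hM₀⟩ := h₁ ν T hν hT u p hsol hLH hdec
  obtain ⟨M₁, hM₁⟩ := hbdd δ hδ
  refine h₂ ν T hν hT u p hsol hLH hdec (max M₀ M₁) fun t ht x => ?_
  by_cases hle : t ≤ δ
  · exact (hM₀ t ⟨ht.1, hle⟩ x).trans (le_max_left _ _)
  · exact (hM₁ t ⟨not_le.mp hle, ht.2⟩ x).trans (le_max_right _ _)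

end Summit.NavierStokesRegularity.NavierStokesRegularity.Cruxes.DeceleratingSetHeadBound.BirthBoundedFlowHeadCeiling
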